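import Literature.Geometry.Kaehler.ComplexTorusPolarizationTypeSimilitude
import Literature.Geometry.Kaehler.ComplexTorusNeronSeveriEndomorphisms
import Literature.AlgebraicGeometry.ModuliOfAbelianVarieties.SymplecticSimilitudeGroup
import HarnessLib

/-!
# The integer Gram matrix of the polarisation descended through a Hecke kernel, in the moved lattice frame, is `E_δ` again

Topic `AlgebraicGeometry/ModuliOfAbelianVarieties` (torus lemmas in `Literature.Geometry.Kaehler.ComplexTorus`, the Siegel
corollary in `Literature.AlgebraicGeometry.ModuliOfAbelianVarieties`).  THEOREMS ONLY (no definition, no named fact, no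
instance, no notation, no `sorry`; net Literature debt 0).  Cell hodgecm-mathlib (D-0151), E-road / HECKE-LINK line for
`stub_noThinPiece`, socket (B) sub-brick (β3) ROUTE F (B-plan1 (g14) ruling 20:04:44Z): brick **(F3) «`intGram` in the
`γ`-moved basis = `typeForm δ`»** — the `hT` input of ★ `isAdmissibleAt_of_levelReading_of_intGram_eq_typeForm`
(`SiegelPairingReadOfTypeFrame`) for the ISOGENY QUOTIENT of the Hecke link, from the source frame (F1) (★
`exists_ahData_intGram_eq_typeForm_of_symplecticLift`) and the lattice similitude (QA3) of the link.

## The mathematics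

Let `X′ = E/Φ(ℤ^ι)` be a complex torus with a Néron–Severi form `η` whose integer Gram matrix in the lattice frame `Φ` is
`G = intGram Φ η` ([Lange2023AbelianVarietiesComplex] §1.5.1).  Let `h : ℝ^ι ≃ ℝ^ι` be a real-linear automorphism acting on
the frame as a SIMILITUDE of `G`: `η(Φ(hm), Φ(hn)) = ν · η(Φm, Φn)` for `m, n ∈ ℤ^ι` (for a matrix `T` with `h v = T v`
this is `ᵗT G T = ν G`, `transpose_mul_latticeGram_mul_eq_smul_iff`).  The quotient torus of the Hecke link is
`X₁ = E/Φ(h⁻¹ℤ^ι)` with lattice frame `Φ₁ := Φ ∘ h⁻¹ = h.symm.trans Φ` and descended form `ν • η` ([MumfordAV1970] §23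
Thm. 2; ★ `Kaehler.ComplexTorus.IsPolarizationType.of_similitude`).  Then

* `ν • η` is a Néron–Severi form for `Φ₁` (`IsNSForm.of_similitude`) and its real and integer Gram matrices in the frame
  `Φ₁` EQUAL those of `η` in the frame `Φ` (`latticeGram_symm_trans_smul_eq`, `intGram_symm_trans_smul_eq`):
  `ν η(Φh⁻¹eᵢ, Φh⁻¹eⱼ) = η(Φeᵢ, Φeⱼ)` — ★ `smul_apply_symm_trans_eq_of_forall_intVec` read on the standard basis;
* SIEGEL COROLLARY (`intGram_symm_trans_smul_eq_typeForm`): if the source frame is symplectic of type `δ`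
  (`intGram Φ η = typeForm δ`, the output of (F1)) and `h` acts by a rational similitude `γ` of `E_δ` with multiplier `ν`
  (`ᵗγ E_δ γ = ν E_δ` over `ℚ`, the link's lattice clause (QA3)), then `intGram (h.symm.trans Φ) (ν • η) = typeForm δ` —
  the moved frame of the quotient is again symplectic of type `δ` ([Lange2023AbelianVarietiesComplex] §3.1 / [LangeBirkenhake1992]
  §8.1: the period matrix of a polarised abelian variety of type `D` in a symplectic basis; [Milne2005ShimuraVarieties] §6
  Thm. 6.11, `ψ ↦` a multiple of `E_δ` under the marking).

Consumers (cell hodgecm-mathlib): B-p14 (g14)'s (β3)/(F2) (AH transport along the torus isogeny) feeds `p_B.form = ν • p′.form`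
and the moved frame `Φ_B = h.symm.trans Φ′` (with `h` acting by `γq`); this file turns (F1)'s `intGram Φ′ p′.form = typeForm δ`
into the quotient's `intGram Φ_B p_B.form = typeForm δ`.  HC_CM is proved only modulo the 7 printed citations until rung 0
closes; this file discharges none of them.

## References
* [Lange2023AbelianVarietiesComplex] H. Lange, *Abelian Varieties over the Complex Numbers* (2023), §1.5.1 (type of a
  polarisation, p. 46), §2.7 Prop. 2.7.2 / Cor. 2.7.3 (isogenies and descended polarisations), §3.1.1 Prop. 3.1.1.
* [MumfordAV1970] D. Mumford, *Abelian Varieties* (1970), §23 Thm. 2 (p. 231).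
* [LangeBirkenhake1992] H. Lange, Ch. Birkenhake, *Complex Abelian Varieties* (1992), §8.1 Prop. 8.1.1.
* [Milne2005ShimuraVarieties] J. S. Milne, *Introduction to Shimura Varieties* (2005), §6 Thm. 6.11 pp. 74–75.
-/

set_option autoImplicit false

noncomputable section

open Matrix

namespace Literature.Geometry.Kaehler.ComplexTorus

variable {ι : Type*} {E : Type*} [NormedAddCommGroup E] [NormedSpace ℂ E]
  {Φ : (ι → ℝ) ≃L[ℝ] E} {η : E [⋀^Fin 2]→L[ℝ] ℝ}

/-! ### §1 The descended form `ν • η` in the moved frame `Φ ∘ h⁻¹` -/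

/-- **`ν • η` is a Néron–Severi form for the moved frame `Φ ∘ h⁻¹`** when `h` is a similitude of the lattice form with
multiplier `ν` on integer vectors: type `(1,1)` scales, and integrality on the bigger lattice `Φ(h⁻¹ℤ^ι)` is the similitude
relation read backwards (★ `smul_apply_symm_trans_eq_of_forall_intVec`). [cite: Lange2023AbelianVarietiesComplex, §1.5.1 (p. 46) and §2.7]
[cite: MumfordAV1970, §23 Thm. 2 (p. 231)] -/
theorem IsNSForm.of_similitude [Fintype ι] [DecidableEq ι] (hη : IsNSForm Φ η) (h : (ι → ℝ) ≃L[ℝ] (ι → ℝ)) (ν : ℝ)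
    (hsim : ∀ m n : ι → ℤ, η ![Φ (h (intVec m)), Φ (h (intVec n))] = ν * η ![Φ (intVec m), Φ (intVec n)]) :
    IsNSForm (h.symm.trans Φ) (ν • η) := by
  refine ⟨fun u v => ?_, fun m n => ?_⟩
  · rw [ContinuousAlternatingMap.smul_apply, ContinuousAlternatingMap.smul_apply, hη.type_one_one]
  · obtain ⟨k, hk⟩ := hη.integral m n
    refine ⟨k, ?_⟩
    rw [show latticeVec (h.symm.trans Φ) m = (h.symm.trans Φ) (intVec m) from rfl,
      show latticeVec (h.symm.trans Φ) n = (h.symm.trans Φ) (intVec n) from rfl,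
      smul_apply_symm_trans_eq_of_forall_intVec h ν hsim]
    exact hk

/-- **The real Gram matrix is preserved**: `latticeGram (Φ ∘ h⁻¹) (ν • η) = latticeGram Φ η` for a similitude `h` of
multiplier `ν`. [cite: Lange2023AbelianVarietiesComplex, §1.5.1 (p. 46)] -/
theorem latticeGram_symm_trans_smul_eq [Fintype ι] [DecidableEq ι] (h : (ι → ℝ) ≃L[ℝ] (ι → ℝ)) (ν : ℝ)
    (hsim : ∀ m n : ι → ℤ, η ![Φ (h (intVec m)), Φ (h (intVec n))] = ν * η ![Φ (intVec m), Φ (intVec n)]) :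
    latticeGram (h.symm.trans Φ) (ν • η) = latticeGram Φ η := by
  ext i j
  rw [latticeGram_apply, latticeGram_apply, smul_apply_symm_trans_eq_of_forall_intVec h ν hsim]

/-- **The integer Gram matrix is preserved**: `intGram (Φ ∘ h⁻¹) (ν • η) = intGram Φ η` for a Néron–Severi form `η` and a
similitude `h` of multiplier `ν` — the SAME symplectic basis serves the quotient ([MumfordAV1970] §23 Thm. 2: the form
descended through the finite kernel `h⁻¹ℤ^ι/ℤ^ι`). [cite: Lange2023AbelianVarietiesComplex, §1.5.1 (p. 46)]
[cite: MumfordAV1970, §23 Thm. 2 (p. 231)] -/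
theorem intGram_symm_trans_smul_eq [Fintype ι] [DecidableEq ι] (hη : IsNSForm Φ η) (h : (ι → ℝ) ≃L[ℝ] (ι → ℝ)) (ν : ℝ)
    (hsim : ∀ m n : ι → ℤ, η ![Φ (h (intVec m)), Φ (h (intVec n))] = ν * η ![Φ (intVec m), Φ (intVec n)]) :
    intGram (h.symm.trans Φ) (ν • η) = intGram Φ η :=
  intGram_eq_of_map_eq (hη.of_similitude h ν hsim)
    (by rw [map_intGram Φ hη, latticeGram_symm_trans_smul_eq h ν hsim])

/-! ### §2 The similitude relation from a matrix identity `ᵗT G T = ν G` -/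

/-- **Matrix form of the similitude hypothesis**: if `h` acts on vectors by the real matrix `T` and `ᵗT · G · T = ν · G` for the
real Gram matrix `G = latticeGram Φ η`, then `η(Φ(hx), Φ(hy)) = ν η(Φx, Φy)` for ALL real `x, y` (in particular on `ℤ^ι`).
[cite: Lange2023AbelianVarietiesComplex, §1.5.1 (p. 46)] -/
theorem apply_comp_eq_mul_of_transpose_mul_latticeGram_mul [Fintype ι] [DecidableEq ι] (h : (ι → ℝ) ≃L[ℝ] (ι → ℝ))
    (T : Matrix ι ι ℝ) (hT : ∀ v : ι → ℝ, h v = T *ᵥ v) (ν : ℝ) (hsim : Tᵀ * latticeGram Φ η * T = ν • latticeGram Φ η)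
    (x y : ι → ℝ) : η ![Φ (h x), Φ (h y)] = ν * η ![Φ x, Φ y] := by
  rw [hT, hT, ← dotProduct_latticeGram_mulVec, ← dotProduct_latticeGram_mulVec, ← Matrix.vecMul_transpose T x,
    ← Matrix.dotProduct_mulVec, Matrix.mulVec_mulVec, Matrix.mulVec_mulVec, hsim, Matrix.smul_mulVec, dotProduct_smul,
    smul_eq_mul]

/-- The integer-vector instance of `apply_comp_eq_mul_of_transpose_mul_latticeGram_mul` (the `hsim` shape of ★
`IsPolarizationType.of_similitude` / `intGram_symm_trans_smul_eq`). [cite: Lange2023AbelianVarietiesComplex, §1.5.1 (p. 46)] -/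
theorem forall_intVec_apply_comp_eq_mul_of_transpose_mul_latticeGram_mul [Fintype ι] [DecidableEq ι]
    (h : (ι → ℝ) ≃L[ℝ] (ι → ℝ)) (T : Matrix ι ι ℝ) (hT : ∀ v : ι → ℝ, h v = T *ᵥ v) (ν : ℝ)
    (hsim : Tᵀ * latticeGram Φ η * T = ν • latticeGram Φ η) :
    ∀ m n : ι → ℤ, η ![Φ (h (intVec m)), Φ (h (intVec n))] = ν * η ![Φ (intVec m), Φ (intVec n)] :=
  fun m n => apply_comp_eq_mul_of_transpose_mul_latticeGram_mul h T hT ν hsim (intVec m) (intVec n)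

end Literature.Geometry.Kaehler.ComplexTorus

/-! ### §3 Siegel corollary: the moved frame of the Hecke quotient is symplectic of type `δ` -/

namespace Literature.AlgebraicGeometry.ModuliOfAbelianVarieties

open Literature.Geometry.Kaehler Literature.Geometry.Kaehler.ComplexTorus

variable {g : ℕ} {δ : Fin g → ℕ} {E : Type*} [NormedAddCommGroup E] [NormedSpace ℂ E]
  {Φ : (Fin g ⊕ Fin g → ℝ) ≃L[ℝ] E} {η : E [⋀^Fin 2]→L[ℝ] ℝ}

/-- Casting the rational similitude identity `ᵗγ E_δ γ = ν E_δ` to `ℝ`. [cite: Milne2005ShimuraVarieties, §6 pp. 67–70 (the multiplier)] -/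
theorem transpose_mul_typeFormOver_real_mul_eq_smul_of_rat (γq : Matrix (Fin g ⊕ Fin g) (Fin g ⊕ Fin g) ℚ) {ν : ℚ}
    (hQA3 : γqᵀ * typeFormOver δ ℚ * γq = ν • typeFormOver δ ℚ) :
    (γq.map (Rat.castHom ℝ))ᵀ * typeFormOver δ ℝ * γq.map (Rat.castHom ℝ) = (ν : ℝ) • typeFormOver δ ℝ := by
  have h := congrArg (fun M : Matrix (Fin g ⊕ Fin g) (Fin g ⊕ Fin g) ℚ => M.map (Rat.castHom ℝ)) hQA3
  simp only [Matrix.map_mul, typeFormOver_map] at h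
  rw [← Matrix.transpose_map, h]
  ext i j
  simp [Matrix.smul_apply, typeFormOver_apply]

/-- `typeFormOver δ ℝ` is the real image of the integer Gram matrix `typeForm δ`. [cite: GenestierNgo2020, §1.2 (symplectic basis of type D)] -/
theorem typeForm_map_intCast_real : (typeForm δ).map (Int.cast : ℤ → ℝ) = typeFormOver δ ℝ := rfl

/-- **(F3) THE MOVED FRAME OF THE HECKE QUOTIENT IS SYMPLECTIC OF TYPE `δ`.**  Let the source frame `Φ` be symplectic of
type `δ` for the Néron–Severi form `η` (`intGram Φ η = typeForm δ` — the output of (F1) ★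
`exists_ahData_intGram_eq_typeForm_of_symplecticLift`), and let `h : ℝ^{2g} ≃ ℝ^{2g}` act by a rational similitude `γq` of `E_δ`
with multiplier `ν` (`ᵗγq E_δ γq = ν E_δ`, the Hecke link's lattice clause (QA3)).  Then the descended form `ν • η` of the
quotient torus `E/Φ(γq⁻¹ℤ^{2g})` has integer Gram matrix `typeForm δ` in the moved frame `h.symm.trans Φ` — the `hT` input of ★
`isAdmissibleAt_of_levelReading_of_intGram_eq_typeForm` for the isogeny quotient.
[cite: Lange2023AbelianVarietiesComplex, §1.5.1 (p. 46) and §3.1.1 Prop. 3.1.1] [cite: MumfordAV1970, §23 Thm. 2 (p. 231)]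
[cite: Milne2005ShimuraVarieties, §6 Thm. 6.11 pp. 74–75] -/
theorem intGram_symm_trans_smul_eq_typeForm (hη : IsNSForm Φ η) (hT : intGram Φ η = typeForm δ)
    (h : (Fin g ⊕ Fin g → ℝ) ≃L[ℝ] (Fin g ⊕ Fin g → ℝ)) (γq : Matrix (Fin g ⊕ Fin g) (Fin g ⊕ Fin g) ℚ)
    (hh : ∀ v : Fin g ⊕ Fin g → ℝ, h v = γq.map (Rat.castHom ℝ) *ᵥ v) {ν : ℚ}
    (hQA3 : γqᵀ * typeFormOver δ ℚ * γq = ν • typeFormOver δ ℚ) :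
    intGram (h.symm.trans Φ) ((ν : ℝ) • η) = typeForm δ := by
  have hG : latticeGram Φ η = typeFormOver δ ℝ := by
    rw [← map_intGram Φ hη, hT, typeForm_map_intCast_real]
  have hsim : (γq.map (Rat.castHom ℝ))ᵀ * latticeGram Φ η * γq.map (Rat.castHom ℝ) = (ν : ℝ) • latticeGram Φ η := by
    rw [hG]
    exact transpose_mul_typeFormOver_real_mul_eq_smul_of_rat γq hQA3
  rw [intGram_symm_trans_smul_eq hη h (ν : ℝ)
    (forall_intVec_apply_comp_eq_mul_of_transpose_mul_latticeGram_mul h _ hh (ν : ℝ) hsim), hT]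

/-- The same with the moved frame handed over as ANY frame `Φ₁` that agrees with `Φ ∘ h⁻¹` pointwise (consumers build `Φ₁`
their own way, e.g. from a `GL_{2g}(ℚ)` action). [cite: Lange2023AbelianVarietiesComplex, §1.5.1 (p. 46)] -/
theorem intGram_eq_typeForm_of_frame_eq_symm_trans (hη : IsNSForm Φ η) (hT : intGram Φ η = typeForm δ)
    (h : (Fin g ⊕ Fin g → ℝ) ≃L[ℝ] (Fin g ⊕ Fin g → ℝ)) (γq : Matrix (Fin g ⊕ Fin g) (Fin g ⊕ Fin g) ℚ)
    (hh : ∀ v : Fin g ⊕ Fin g → ℝ, h v = γq.map (Rat.castHom ℝ) *ᵥ v) {ν : ℚ}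
    (hQA3 : γqᵀ * typeFormOver δ ℚ * γq = ν • typeFormOver δ ℚ)
    (Φ₁ : (Fin g ⊕ Fin g → ℝ) ≃L[ℝ] E) (hΦ₁ : ∀ v, Φ₁ v = Φ (h.symm v)) :
    intGram Φ₁ ((ν : ℝ) • η) = typeForm δ := by
  have hΦ : Φ₁ = h.symm.trans Φ := by
    ext v
    rw [hΦ₁, ContinuousLinearEquiv.trans_apply]
  rw [hΦ]
  exact intGram_symm_trans_smul_eq_typeForm hη hT h γq hh hQA3

end Literature.AlgebraicGeometry.ModuliOfAbelianVarieties

end
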